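import Mathlib
import Summits.Ventures.PercRepro2.Defs
import Summits.Ventures.PercRepro2.Harris
import Summits.Ventures.PercRepro2.Graph
import Summits.Ventures.PercRepro2.Events
import Summits.Ventures.PercRepro2.TReduction
import Summits.Ventures.PercRepro2.TReductionBase
import Summits.Ventures.PercRepro2.THBaseEnum
import Summits.Ventures.PercRepro2.THClassVEnum
import Summits.Ventures.PercRepro2.THClassVPlusGraph
import Summits.Ventures.PercRepro2.THClassVPlusEnum

/-!
# Slice G of the base-case census of `G₅⁺` (class (v) plus `r–h`) (mine-a g50)

Leading states `120…`, `121…`.  Every lemma is a kernel evaluation (`decide +kernel`, at most `2^17` leaves each) of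
`THClassVPlus.enum` over all patterns of the remaining edges: the antipodal base case of `G₅⁺` at
the pair `({x₆ ∈ T}, {x₄, x₅ ∈ T})` is nonnegative at every pinning in this slice.  Together
(`THClassVPlus.enum_nonneg`) the slices cover every pattern other than «every edge free» and the
negative one «`r–h` closed, the rest free» (`THClassVPlusEnum.enum_neg`).  No instance, no notation.
-/

namespace Summit.Ventures.PercRepro2

namespace THClassVPlus

set_option maxHeartbeats 0 in
/-- Leading states `120` (edges `r x₂` … `r x₄`): `131072` leaves. -/
lemma slice_120 : ∀ s3 s4 s5 s6 s7 s8 s9 s10 : Fin 3, 0 ≤ enum 1 2 0 s3 s4 s5 s6 s7 s8 s9 s10 := by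
  decide +kernel

set_option maxHeartbeats 0 in
/-- Leading states `121` (edges `r x₂` … `r x₄`): `131072` leaves. -/
lemma slice_121 : ∀ s3 s4 s5 s6 s7 s8 s9 s10 : Fin 3, 0 ≤ enum 1 2 1 s3 s4 s5 s6 s7 s8 s9 s10 := by
  decide +kernel


end THClassVPlus

end Summit.Ventures.PercRepro2
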